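import Literature.IUT.HodgeTheaters.InitialThetaDataCurveModelLocal
import Literature.IUT.HodgeTheaters.InitialThetaDataAbsoluteGaloisMoves
import HarnessLib

/-!
# [IUTchI] Def. 3.1 / [AbsTopIII] Def. 1.7, Thm. 1.9 (d): at the named curve models of an initial Θ-datum the
# MODEL-INTRINSIC Galois action on the constants `k̄ ⊇ k̄_NF` (through `Π_U ↠ G_U ≅ Gal(k^alg/k)`) moves an
# algebraic number, at every global curve `C_F, X_F, C_K, X_K`

S. Mochizuki, *Inter-universal Teichmüller theory I*, §3, Definition 3.1 (a), (b), (d) (kurims final manuscript,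
May 2020, pp. 61–62) [claim: Mochizuki2012, status: disputed]; S. Mochizuki, *Topics in Absolute Anabelian
Geometry III*, §1, Def. 1.7 ("`k̄_NF ⊆ k̄`"), Thm. 1.9 (d) ("the natural isomorphism `G_k ≅ Gal(k̄/k)` … the subfield
`k̄_NF ⊆ k̄`") [MochizukiAbsTopIII2015].  abc-iut cell, GAP B `G-L5t9g8-1` ([IUTchI] Ex. 5.4 (iv)) — item GB-07
add-on (the named model `InitialThetaData.nfCurveModel`, `InitialThetaDataCurveModel.lean`).

WHAT IS PROVED.  A `[AbsTopIII] CurveModel` records, for every curve `U`, the isomorphism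
`galIso U : (ext U).gal ≅ absoluteGaloisGrp (base U)` in `ProfiniteGrp`; composing with the augmentation
`(ext U).aug : Π_U ↠ G_U` and Mathlib's identification `Field.absoluteGaloisGroup.toAlgEquiv`, every `g ∈ Π_U` ACTS
on `k^alg = AlgebraicClosure (base U) ⊇ k̄_NF = M.kbarNF U` — the model-intrinsic action on CONSTANTS (no extra
datum needed, in contrast with the action on `K_{Z_NF}`, which `CurveModel` does not record).  For a curve whose
base field is a NUMBER FIELD this action is NON-TRIVIAL: some `g ∈ Π_U` moves some `y ∈ k̄_NF = k^alg`
(`NFCurveModel.exists_galIso_aug_apply_ne_kbarNF`; every `y ∉ k` is moved by some `g`,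
`NFCurveModel.exists_galIso_aug_apply_ne_of_not_mem_range`), because `galIso U` is an isomorphism, `aug` is onto,
and `Gal(k^alg/k)` moves every element of `k^alg ∖ k ≠ ∅`
(`Literature/NumberTheory/NumberFields/NotAlgebraicallyClosed.lean`).  Instantiated BY NAME at the four global
curves of `D.nfCurveModelOfPoints N`, of `D.nfCurveModel`, and of GB-13's enriched model `D.nfCurveModelLocal G`
(`globalCurve G i`; same `base`/`ext`/`galIso` by `rfl`), whose base fields are the number fields `F`, `F`, `K`, `K`
(`numberField_base`); at `C_F` the action is, on the nose, `y ↦ ι (augGF g (ι⁻¹ y))` with `ι = D.algClosureEquivF`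
(`toAlgEquiv_galIso_aug_CF`, `rfl`).

PURPOSE (chair's RULINGS #356 / spec-keeper B `X143-CURE-DESIGN.md` v0.3 (i-d), the OPTIONAL constant-field
strengthening `ConstEquivariantAt` of `Thm_1_9'`): its non-transparency lemma
`not_constEquivariantAt_of_constEquiv_eq_refl` carries the hypothesis
`hmove : ∃ (g : (M.ext X).arith) (y : M.kbarNF X), toAlgEquiv (M.base X) ((M.galIso X).hom.hom ((M.ext X).aug g)) y ≠ y`;
this file DISCHARGES `hmove` at every global curve of the named models (and at any curve of any model over a number
field), so that strengthening — if taken — is unconditional at the binder of record.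

HONEST LABEL: elementary field theory at OUR typed objects (`galIso` is a GENUINE transport at the datum,
`InitialThetaDataAbsoluteGalois.lean`); nothing here asserts [AbsTopIII] Thm. 1.9 or any reconstruction
statement, no side is taken on [IUTchIII] Cor. 3.12; abc is not proved; no `instance`, no notation.
-/

noncomputable section

namespace Literature.IUT.HodgeTheaters

open CategoryTheory
open Literature.AnabelianGeometry.AbsoluteAnabelian
open Literature.AnabelianGeometry.AbsoluteAnabelian.AbsTopIII

universe u

/-! ### Generic: a curve of a `CurveModel` whose base field is a number field -/

namespace NFCurveModel

variable (M : CurveModel.{u}) (U : M.Curve)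

/-- `k̄_NF = k^alg` when the base field `k` is a number field: the algebraic closure of `ℚ` in `k^alg` is
everything ([AbsTopIII] Def. 1.7 "`k̄_NF ⊆ k̄` the algebraic closure of `ℚ`"; the instance at the named models is
`InitialThetaData.kbarNF_nfCurveModelOfPoints_eq_top`). [cite: MochizukiAbsTopIII2015, Def 1.7 p.35] -/
theorem kbarNF_eq_top [NumberField (M.base U)] : M.kbarNF U = ⊤ := by
  haveI : Algebra.IsAlgebraic ℚ (AlgebraicClosure (M.base U)) :=
    Algebra.IsAlgebraic.trans ℚ (M.base U) (AlgebraicClosure (M.base U))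
  exact le_antisymm le_top fun x _ => (mem_algebraicClosure_iff).2 (Algebra.IsAlgebraic.isAlgebraic x)

/-- The model-intrinsic action of `g ∈ Π_U` on the constants `k^alg`: `y ↦ toAlgEquiv k ((galIso U).hom.hom (aug g)) y`
([AbsTopIII] Thm. 1.9 (d) "the natural isomorphism `G_k ≅ Gal(k̄/k)`").  Every `τ ∈ Gal(k^alg/k)` is so realised
(`galIso` is an isomorphism, `aug` is onto). [cite: MochizukiAbsTopIII2015, Thm 1.9 p.37] -/
theorem exists_aug_galIso_eq (τ : AlgebraicClosure (M.base U) ≃ₐ[M.base U] AlgebraicClosure (M.base U)) :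
    ∃ g : (M.ext U).arith,
      Field.absoluteGaloisGroup.toAlgEquiv (M.base U) ((M.galIso U).hom.hom ((M.ext U).aug g)) = τ := by
  obtain ⟨g, hg⟩ := (M.ext U).aug_surjective
    ((M.galIso U).inv ((Field.absoluteGaloisGroup.toAlgEquiv (M.base U)).symm τ))
  refine ⟨g, ?_⟩
  rw [hg, CategoryTheory.Iso.inv_hom_id_apply, MulEquiv.apply_symm_apply]

/-- **Over a number field, every `y ∈ k^alg ∖ k` is moved by some `g ∈ Π_U`** through `galIso ∘ aug`
(`Gal(k^alg/k)` moves `y`: `Literature.NumberTheory.NumberFields.exists_algEquiv_apply_ne_of_not_mem_range`).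
[cite: MochizukiAbsTopIII2015, Thm 1.9 p.37] -/
theorem exists_galIso_aug_apply_ne_of_not_mem_range [NumberField (M.base U)] {y : AlgebraicClosure (M.base U)}
    (hy : y ∉ Set.range (algebraMap (M.base U) (AlgebraicClosure (M.base U)))) :
    ∃ g : (M.ext U).arith,
      Field.absoluteGaloisGroup.toAlgEquiv (M.base U) ((M.galIso U).hom.hom ((M.ext U).aug g)) y ≠ y := by
  obtain ⟨τ, hτ⟩ := Literature.NumberTheory.NumberFields.exists_algEquiv_apply_ne_of_not_mem_range
    (M.base U) (AlgebraicClosure (M.base U)) hy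
  obtain ⟨g, hg⟩ := exists_aug_galIso_eq M U τ
  exact ⟨g, by rw [hg]; exact hτ⟩

/-- **Over a number field the model-intrinsic Galois action on constants is non-trivial**: some `g ∈ Π_U` moves
some `y ∈ k^alg`. [cite: MochizukiAbsTopIII2015, Thm 1.9 p.37] -/
theorem exists_galIso_aug_apply_ne [NumberField (M.base U)] :
    ∃ (g : (M.ext U).arith) (y : AlgebraicClosure (M.base U)),
      Field.absoluteGaloisGroup.toAlgEquiv (M.base U) ((M.galIso U).hom.hom ((M.ext U).aug g)) y ≠ y := by
  obtain ⟨τ, y, h⟩ := Literature.NumberTheory.NumberFields.exists_algEquiv_apply_ne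
    (M.base U) (AlgebraicClosure (M.base U))
  obtain ⟨g, hg⟩ := exists_aug_galIso_eq M U τ
  exact ⟨g, y, by rw [hg]; exact h⟩

/-- The same with `y` typed in `k̄_NF = M.kbarNF U` (which is all of `k^alg` over a number field) — the shape of
the `hmove` hypothesis of the constant-field non-transparency lemma (`X143-CURE-DESIGN.md` (i-d)).
[cite: MochizukiAbsTopIII2015, Thm 1.9 p.37] -/
theorem exists_galIso_aug_apply_ne_kbarNF [NumberField (M.base U)] :
    ∃ (g : (M.ext U).arith) (y : M.kbarNF U),
      Field.absoluteGaloisGroup.toAlgEquiv (M.base U) ((M.galIso U).hom.hom ((M.ext U).aug g))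
        (y : AlgebraicClosure (M.base U)) ≠ y := by
  obtain ⟨g, y, h⟩ := exists_galIso_aug_apply_ne M U
  have hy : y ∈ M.kbarNF U := by
    rw [kbarNF_eq_top]
    exact IntermediateField.mem_top
  exact ⟨g, ⟨y, hy⟩, h⟩

end NFCurveModel

/-! ### At the datum: the four global curves of the named models -/

namespace InitialThetaData

variable {F K Fbar : Type u} [Field F] [NumberField F] [Field K] [NumberField K] [Algebra F K]
  [Field Fbar] [Algebra F Fbar] [Algebra K Fbar] {E : WeierstrassCurve F} [E.IsElliptic] {l : ℕ}
  {Pb : BadPlacePredicates K} (D : InitialThetaData F K Fbar E l Pb)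

/-- The base fields `F`, `F`, `K`, `K` of the four global curves `C_F`, `X_F`, `C_K`, `X_K` are number fields
(Def. 3.1 (a), (c); a `theorem`, not an instance). [claim: Mochizuki2012, status: disputed] -/
theorem numberField_base (N : D.NFPointData) (U : (D.nfCurveModelOfPoints N).Curve) :
    NumberField ((D.nfCurveModelOfPoints N).base U) := by
  obtain ⟨_ | _ | _ | _⟩ := U
  · exact (inferInstance : NumberField F)
  · exact (inferInstance : NumberField F)
  · exact (inferInstance : NumberField K)
  · exact (inferInstance : NumberField K)

/-- The base field of a global curve of GB-13's enriched model `D.nfCurveModelLocal G` is a number field.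
[claim: Mochizuki2012, status: disputed] -/
theorem numberField_base_global (G : D.LocalThetaGeometry) (i : NFCurveIndex) :
    NumberField ((D.nfCurveModelLocal G).base (D.globalCurve G i)) :=
  D.numberField_base G.nfPointData (ULift.up i)

/-- **At every global curve of `D.nfCurveModelOfPoints N` some `g ∈ Π_U` moves some `y ∈ k̄_NF`** through the
model's `galIso U` (`galIsoCF/XF/CK/XK`, genuine transports of the datum's `galIso`) — the `hmove` shape at the
named model (Def. 3.1 (a), (b), (d)). [claim: Mochizuki2012, status: disputed] -/
theorem exists_galIso_aug_apply_ne_nfCurveModelOfPoints (N : D.NFPointData) (U : (D.nfCurveModelOfPoints N).Curve) :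
    ∃ (g : ((D.nfCurveModelOfPoints N).ext U).arith) (y : (D.nfCurveModelOfPoints N).kbarNF U),
      Field.absoluteGaloisGroup.toAlgEquiv ((D.nfCurveModelOfPoints N).base U)
          (((D.nfCurveModelOfPoints N).galIso U).hom.hom (((D.nfCurveModelOfPoints N).ext U).aug g))
          (y : AlgebraicClosure ((D.nfCurveModelOfPoints N).base U)) ≠ y := by
  haveI := D.numberField_base N U
  exact NFCurveModel.exists_galIso_aug_apply_ne_kbarNF _ U

/-- At every global curve of `D.nfCurveModelOfPoints N`, every `y ∈ k^alg ∖ k` is moved by some `g ∈ Π_U`.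
[claim: Mochizuki2012, status: disputed] -/
theorem exists_galIso_aug_apply_ne_of_not_mem_range_nfCurveModelOfPoints (N : D.NFPointData)
    (U : (D.nfCurveModelOfPoints N).Curve) {y : AlgebraicClosure ((D.nfCurveModelOfPoints N).base U)}
    (hy : y ∉ Set.range (algebraMap ((D.nfCurveModelOfPoints N).base U) _)) :
    ∃ g : ((D.nfCurveModelOfPoints N).ext U).arith,
      Field.absoluteGaloisGroup.toAlgEquiv ((D.nfCurveModelOfPoints N).base U)
          (((D.nfCurveModelOfPoints N).galIso U).hom.hom (((D.nfCurveModelOfPoints N).ext U).aug g)) y ≠ y := by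
  haveI := D.numberField_base N U
  exact NFCurveModel.exists_galIso_aug_apply_ne_of_not_mem_range _ U hy

/-- **At every curve of `D.nfCurveModel` some `g ∈ Π_U` moves some `y ∈ k̄_NF`** (the four global curves
`C_F, X_F, C_K, X_K`; Def. 3.1 (a), (b), (d)). [claim: Mochizuki2012, status: disputed] -/
theorem exists_galIso_aug_apply_ne_nfCurveModel (U : D.nfCurveModel.Curve) :
    ∃ (g : (D.nfCurveModel.ext U).arith) (y : D.nfCurveModel.kbarNF U),
      Field.absoluteGaloisGroup.toAlgEquiv (D.nfCurveModel.base U)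
          ((D.nfCurveModel.galIso U).hom.hom ((D.nfCurveModel.ext U).aug g))
          (y : AlgebraicClosure (D.nfCurveModel.base U)) ≠ y :=
  D.exists_galIso_aug_apply_ne_nfCurveModelOfPoints (NFPointData.empty D) U

/-- **At every GLOBAL curve of GB-13's enriched model `D.nfCurveModelLocal G` (the binder-of-record model) some
`g ∈ Π_U` moves some `y ∈ k̄_NF`** — `hmove` of the constant-field non-transparency lemma at the named pair
(Def. 3.1 (a), (b), (d)). [claim: Mochizuki2012, status: disputed] -/
theorem exists_galIso_aug_apply_ne_global (G : D.LocalThetaGeometry) (i : NFCurveIndex) :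
    ∃ (g : ((D.nfCurveModelLocal G).ext (D.globalCurve G i)).arith)
      (y : (D.nfCurveModelLocal G).kbarNF (D.globalCurve G i)),
      Field.absoluteGaloisGroup.toAlgEquiv ((D.nfCurveModelLocal G).base (D.globalCurve G i))
          (((D.nfCurveModelLocal G).galIso (D.globalCurve G i)).hom.hom
            (((D.nfCurveModelLocal G).ext (D.globalCurve G i)).aug g))
          (y : AlgebraicClosure ((D.nfCurveModelLocal G).base (D.globalCurve G i))) ≠ y := by
  haveI := D.numberField_base_global G i
  exact NFCurveModel.exists_galIso_aug_apply_ne_kbarNF _ _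

/-- At every global curve of `D.nfCurveModelLocal G`, every `y ∈ k^alg ∖ k` is moved by some `g ∈ Π_U`.
[claim: Mochizuki2012, status: disputed] -/
theorem exists_galIso_aug_apply_ne_of_not_mem_range_global (G : D.LocalThetaGeometry) (i : NFCurveIndex)
    {y : AlgebraicClosure ((D.nfCurveModelLocal G).base (D.globalCurve G i))}
    (hy : y ∉ Set.range (algebraMap ((D.nfCurveModelLocal G).base (D.globalCurve G i)) _)) :
    ∃ g : ((D.nfCurveModelLocal G).ext (D.globalCurve G i)).arith,
      Field.absoluteGaloisGroup.toAlgEquiv ((D.nfCurveModelLocal G).base (D.globalCurve G i))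
          (((D.nfCurveModelLocal G).galIso (D.globalCurve G i)).hom.hom
            (((D.nfCurveModelLocal G).ext (D.globalCurve G i)).aug g)) y ≠ y := by
  haveI := D.numberField_base_global G i
  exact NFCurveModel.exists_galIso_aug_apply_ne_of_not_mem_range _ _ hy

/-! ### At `C_F` the constant action IS the coefficient action `augGF`, transported along `ι : F̄ ≅ F^alg` -/

/-- At `C_F` (any points `N`): the model-intrinsic action of `g ∈ Π_{C_F}` on `F^alg` is
`y ↦ ι (augGF g (ι⁻¹ y))`, `ι = D.algClosureEquivF : F̄ ≃ₐ[F] F^alg` — the SAME element of `G_F` as the coefficient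
action `ratFuncMapCoeffs (augGF g)` on `F̄(t)` (`rfl`; Def. 3.1 (b)). [claim: Mochizuki2012, status: disputed] -/
theorem toAlgEquiv_galIso_aug_CF (N : D.NFPointData) (g : D.geom.extF.arith) (y : AlgebraicClosure F) :
    Field.absoluteGaloisGroup.toAlgEquiv F
        (((D.nfCurveModelOfPoints N).galIso (D.nfCurveOfPoints N .CF)).hom.hom (D.geom.extF.aug g)) y =
      D.algClosureEquivF (D.augGF g (D.algClosureEquivF.symm y)) := rfl

/-- At `C_F`: `g ∈ Π_{C_F}` moves the constant `ι c ∈ F^alg` iff `augGF g` moves `c ∈ F̄`.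
[claim: Mochizuki2012, status: disputed] -/
theorem toAlgEquiv_galIso_aug_CF_ne_iff (N : D.NFPointData) (g : D.geom.extF.arith) (c : Fbar) :
    Field.absoluteGaloisGroup.toAlgEquiv F
        (((D.nfCurveModelOfPoints N).galIso (D.nfCurveOfPoints N .CF)).hom.hom (D.geom.extF.aug g))
        (D.algClosureEquivF c) ≠ D.algClosureEquivF c ↔ D.augGF g c ≠ c := by
  rw [toAlgEquiv_galIso_aug_CF, AlgEquiv.symm_apply_apply]
  exact not_congr D.algClosureEquivF.injective.eq_iff

end InitialThetaData

end Literature.IUT.HodgeTheaters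

end
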